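import Mathlib
import Summits.NavierStokesRegularity.NavierStokesRegularity.Theorems.WakeRatchetTailRatchetQuietPastAlphaLimit
import HarnessLib

/-!
# `WakeRatchet.TailRatchet` (stmt-NavierStokesRegularity-21808) — hypothesis class of the tail ratchets:
# the ancient α-limit inherits the ACTION clause (Fatou on windows)

Support file (route `WakeRatchet`; MODEL lattice ODEs of Tao 2016 §4 / §6.4 — nothing here concerns the Navier–Stokes
equations; no item is closed).  Tenth file of the `WakeRatchetQuietPast` series, completing `exists_alpha_limit`
(`…QuietPastAlphaLimit`): the limit `W∞` of the loud far-past frames of a non-trivial uniformly bounded admissible eternal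
solution also satisfies the ACTION clause of the cell's admissibility — every shell `σ ↦ ‖W∞_n(σ)‖` is integrable on `ℝ` with
`∫ ‖W∞_n‖ ≤ M`, the action constant of `W` (`limit_action`: on each window `[a,b]` the frame actions are shifted windows of the
actions of `W`, dominated convergence, then `integrable_of_intervalIntegral_norm_bounded`).  Packaged: `exists_alpha_limit_action`
— the α-limit satisfies `law` (parameter `ν∞ ∈ [0, V⋆]`), `nonneg`, `action`, the uniform bound and non-triviality; of the
clauses of `IsEternalVisc ε₀ ν∞ α W∞ ∧ UniformBound W∞` exactly ONE is missing, the forward energy clause `bdd` (not inherited in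
general — recorded honestly in `…QuietPastAlphaLimit`).

HONEST FRAMING: no stub, crux, rung or summit is proved (stmt-21808 stays dead modulo `WakeRatchetDyadicFront.DyadicScalarFronts`).
-/

noncomputable section

set_option linter.dupNamespace false

namespace Summit.NavierStokesRegularity.NavierStokesRegularity.Theorems

namespace WakeRatchetQuietPast

open Set Filter Topology MeasureTheory
open Literature.Analysis.FluidPDE Literature.Analysis.FluidPDE.TaoCascade
open Summit.NavierStokesRegularity.NavierStokesRegularity.Cruxes.MinimalBlowupExtraction.ClockedFrames (vfield)

variable {ε₀ νh : ℝ} {α : Fin 4 → Fin 4 → Fin 4 → ℤ × ℤ × ℤ → ℝ} {W : ℤ → ℝ → Em 4}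

/-- A shifted window of the action: `∫_a^b ‖W_m(u + s)‖ du ≤ ∫_ℝ ‖W_m‖` for an admissible eternal solution.
[cite: Tao2016AveragedNS, §4 Lemma 4.1 (4.8)–(4.10) (action clause of the cell's `IsEternalVisc`); cell lemma] -/
theorem window_action_le {W : ℤ → ℝ → Em 4} {M : ℝ}
    (hM : ∀ n : ℤ, Integrable (fun σ => ‖W n σ‖) ∧ ∫ σ, ‖W n σ‖ ≤ M) (m : ℤ) (s : ℝ) {a b : ℝ} (hab : a ≤ b) :
    ∫ u in a..b, ‖W m (u + s)‖ ≤ M := by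
  have hshift : ∫ u in a..b, ‖W m (u + s)‖ = ∫ u in (a + s)..(b + s), ‖W m u‖ :=
    intervalIntegral.integral_comp_add_right (fun u => ‖W m u‖) s
  rw [hshift, intervalIntegral.integral_of_le (by linarith)]
  refine le_trans (setIntegral_le_integral (hM m).1 (Eventually.of_forall fun u => norm_nonneg _)) (hM m).2

/-- **The α-limit inherits the action clause.**  If the frames `u ↦ W_{n+k_j}(u + s_j)` of a uniformly bounded admissible
eternal solution converge pointwise (along `φ`) to continuous shells `W∞_n`, then every `‖W∞_n‖` is integrable on `ℝ` with
`∫ ‖W∞_n‖ ≤ M`, `M` the action constant of `W`. [cite: Tao2016AveragedNS, §4 Lemma 4.1 (4.8)–(4.10), §6.4; cell theorem] -/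
theorem limit_action (hW : IsEternalVisc ε₀ νh α W) {C : ℝ} (hC : ∀ (j : ℤ) (σ : ℝ), ‖W j σ‖ ≤ C)
    {k : ℕ → ℤ} {s : ℕ → ℝ} {φ : ℕ → ℕ} {Winf : ℤ → ℝ → Em 4}
    (hconv : ∀ (n : ℤ) (σ : ℝ), Tendsto (fun j => W (n + k (φ j)) (σ + s (φ j))) atTop (𝓝 (Winf n σ)))
    (hcont : ∀ n : ℤ, Continuous (Winf n)) :
    ∃ M : ℝ, ∀ n : ℤ, Integrable (fun σ => ‖Winf n σ‖) ∧ ∫ σ, ‖Winf n σ‖ ≤ M := by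
  obtain ⟨M, hM⟩ := hW.action
  refine ⟨M, fun n => ?_⟩
  have hcn : Continuous (fun σ => ‖Winf n σ‖) := (hcont n).norm
  -- windows
  have hwin : ∀ a b : ℝ, a ≤ b → ∫ u in a..b, ‖Winf n u‖ ≤ M := by
    intro a b hab
    have hlim : Tendsto (fun j => ∫ u in a..b, ‖W (n + k (φ j)) (u + s (φ j))‖) atTop
        (𝓝 (∫ u in a..b, ‖Winf n u‖)) := by
      refine intervalIntegral.tendsto_integral_filter_of_dominated_convergence (fun _ => C) ?_ ?_
        intervalIntegrable_const ?_
      · refine Eventually.of_forall fun j => Continuous.aestronglyMeasurable ?_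
        exact ((WakeRatchetOrthant.continuous_shell hW (n + k (φ j))).comp
          (continuous_id.add continuous_const)).norm
      · exact Eventually.of_forall fun j => ae_of_all _ fun u _ => by
          rw [norm_norm]; exact hC _ _
      · exact ae_of_all _ fun u _ => (hconv n u).norm
    exact le_of_tendsto hlim (Eventually.of_forall fun j => window_action_le hM (n + k (φ j)) (s (φ j)) hab)
  -- integrability on `ℝ` and the total action
  have hfi : ∀ i : ℕ, IntegrableOn (fun σ => ‖Winf n σ‖) (Ioc (-(i : ℝ)) i) := fun i =>
    (hcn.integrableOn_Icc).mono_set Ioc_subset_Icc_self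
  have ha : Tendsto (fun i : ℕ => -(i : ℝ)) atTop atBot :=
    tendsto_neg_atTop_atBot.comp tendsto_natCast_atTop_atTop
  have hb : Tendsto (fun i : ℕ => (i : ℝ)) atTop atTop := tendsto_natCast_atTop_atTop
  have hii : ∀ i : ℕ, -(i : ℝ) ≤ i := fun i => by
    have h0 : (0 : ℝ) ≤ i := Nat.cast_nonneg i
    linarith
  have hInt : Integrable (fun σ => ‖Winf n σ‖) := by
    refine integrable_of_intervalIntegral_norm_bounded M hfi ha hb (Eventually.of_forall fun i => ?_)
    simp only [norm_norm]
    exact hwin _ _ (hii i)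
  exact ⟨hInt, le_of_tendsto' (intervalIntegral_tendsto_integral hInt ha hb) fun i => hwin _ _ (hii i)⟩

/-- **Non-trivial ancient α-limit with law, bound AND action.**  For a non-trivial uniformly bounded admissible eternal solution
(m = 4, any table, any `ν̂ ≥ 0`; `K > 0` a bound of the table constant): an ancient limit `W∞` of loud far-past frames solving
the renormalised lattice with covariant viscosity parameter `ν∞ ∈ [0,(4KC³+1)(64K)²]`, bounded by `C`, with integrable shells of
total action `≤ M`, and `‖W∞_0(0)‖ ≥ 1/(64K)`.  (Only the forward energy clause `bdd` of the cell's admissibility is not claimed.)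
[cite: Tao2016AveragedNS, §4 Lemma 4.1 (4.8)–(4.10), §6.4; cell theorem] -/
theorem exists_alpha_limit_action (hε : -1 < ε₀) (hW : IsEternalVisc ε₀ νh α W) {K C : ℝ}
    (hK : shiftConst α (0, 0, 0) + bigLam ε₀ * shiftConst α (0, 0, 1)
      + (bigLam ε₀)⁻¹ * (shiftConst α (1, 0, 0) + shiftConst α (0, 1, 0)) ≤ K)
    (hK0 : 0 < K) (hC0 : 0 ≤ C) (hC : ∀ (j : ℤ) (σ : ℝ), ‖W j σ‖ ≤ C) (hne : ∃ (n : ℤ) (σ : ℝ), W n σ ≠ 0) :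
    ∃ (νinf : ℝ) (Winf : ℤ → ℝ → Em 4),
      νinf ∈ Icc 0 ((4 * K * C ^ 3 + 1) * (64 * K) ^ 2) ∧
      (∀ (n : ℤ) (σ : ℝ), HasDerivAt (Winf n) (vfield ε₀ α νinf Winf n σ) σ) ∧
      (∀ (n : ℤ) (σ : ℝ), ‖Winf n σ‖ ≤ C) ∧
      (∃ M : ℝ, ∀ n : ℤ, Integrable (fun σ => ‖Winf n σ‖) ∧ ∫ σ, ‖Winf n σ‖ ≤ M) ∧
      1 / (64 * K) ≤ ‖Winf 0 0‖ := by
  obtain ⟨k, s, φ, νinf, Winf, -, -, hν, -, hconv, hlaw, hWb, hW0⟩ :=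
    exists_alpha_limit hε hW hK hK0 hC0 hC hne
  have hcont : ∀ n : ℤ, Continuous (Winf n) :=
    fun n => continuous_iff_continuousAt.2 fun σ => (hlaw n σ).continuousAt
  have hpt : ∀ (n : ℤ) (σ : ℝ), Tendsto (fun j => W (n + k (φ j)) (σ + s (φ j))) atTop (𝓝 (Winf n σ)) :=
    fun n σ => hconv n (fun _ => σ) σ tendsto_const_nhds
  exact ⟨νinf, Winf, hν, hlaw, hWb, limit_action hW hC hpt hcont, hW0⟩

end WakeRatchetQuietPast

end Summit.NavierStokesRegularity.NavierStokesRegularity.Theorems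

end
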